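/-
Copyright (c) 2026 the pub-hodgecm-mathlib formalisation cell (harness21).  Prover seat hodgecm-mathlib-K2E1-p16 (g2), Track B ∕ K2-LIT, h413 = `stmt-HodgeConjecture-24833`,
route of record `HCCMUnconditional`; R90-TF section S8 «ContSpec-n½» (dealer R90-CS-plan (g0), LEAD K2E1-plan (g7)), «U(Φ₃) χ-TWIN #3a» (TWIN-DAG v1 row 5 feeder «hunq_χ₃», law-free;
offered 16:12:51Z): the N = 3 CM head of ★ `K2E1ChiHomogeneousL2U2` (K2E1-p15 (g0)) over ★ `K2E1BLHomogeneousL2U3` (K2E1-p02 (g6)).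
-/
import Summits.HodgeConjecture.HodgeConjecture.Theorems.K2E1ChiHomogeneousL2U2   -- ★ (K2E1-p15 g0): RANK-GENERIC §1–§4a, in particular `hL2_chi_of_lt (σ₀)` (transfer letter `htr`)
import Summits.HodgeConjecture.HodgeConjecture.Theorems.K2E1BLHomogeneousL2U3    -- ★ (K2E1-p02 g6): the N = 3 transfer `memLp_two_of_ae_norm_comp_pZX_le_cm_three` (P2a-ι₃)
import HarnessLib

/-!
# K2·E1 — `K2E1ChiHomogeneousL2U3`: A HOMOGENEOUS SOLUTION OF THE `(χ, τ)` `𝔛`-SYSTEM OF `U(2,1)_{L∕L⁺}` IS IN `L²(G(F)∖G(𝔸), μ)` — the N = 3 CM head `hL2_chi_cm_three`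
# (S8 «U(Φ₃) χ-TWIN» sheet, TWIN-DAG v1 row 5 feeder; the `hL2` letter of the N = 3 `(χ,τ)` uniqueness head `hunq_χ₃`)

Track B ∕ K2-LIT, crux h413 = `stmt-HodgeConjecture-24833`; cell `hodgecm-mathlib`, R90-TF section S8 (Rogawski 1990 §13.9; the U(Φ₃) χ-twins feed R1₃ of S8B#2's road and E-S8-def-cont).
THEOREMS ONLY (no `def`, no `instance`, no notation, no named-fact hypothesis, no `sorry`); lane `--kind proof --supports stmt-HodgeConjecture-24833 --as helper` (count-neutral).
Closes no socket.  INDEXING-FREE (RULING S8-R10 (a)): the statement sees the cuspidal datum only through the finite-dimensional constant-term family `Lz : ℂ → B →L 𝓗_k(Z_a)` and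
the letter `hδL`; no character law.

★ `K2E1ChiHomogeneousL2U2` is rank-generic except for its last head `hL2_chi_cm_two` (CM pair, `N = 2`, `σ₀ = 1`, transfer ★ `memLp_two_of_ae_norm_comp_pZX_le_cm`).  This file is
that head at `N = 3`: `σ₀ = 2` (the abscissa of convergence of the `U(2,1)` Borel Eisenstein series, ★ `K2E1BorelEisensteinGodementCMThree`), transfer ★
`K2E1BLHomogeneousL2U3.memLp_two_of_ae_norm_comp_pZX_le_cm_three` — byte-for-byte `2 ↦ 3`, `1 < Re z ↦ 2 < Re z`, as ★ `hL2_cm_three` twins ★ `hL2_cm_two` in the spherical file.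
* HEAD **`hL2_chi_cm_three`**.  [BernsteinLapid2019, §4 Claim 2 (p. 9), Claims 4–5 (p. 10); MoeglinWaldspurger1995, I.4.10.]
HONEST LABEL: HC_CM is proved only modulo the 7 printed citations (2 remaining named inputs: hLiu418 = `stmt-HodgeConjecture-24832`, h413 = `stmt-HodgeConjecture-24833`) until rung 0
closes; this file asserts no named fact and closes no socket.

## References
* [BernsteinLapid2019] J. Bernstein, E. Lapid, *On the meromorphic continuation of Eisenstein series*, J. AMS 37 (2024) (arXiv:1911.02342), §4 Claims 2, 4, 5 (pp. 9–10).
* [MoeglinWaldspurger1995] C. Mœglin, J.-L. Waldspurger, *Spectral Decomposition and Eisenstein Series* (1995), I.2.12–I.2.13, I.4.10.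
-/

set_option autoImplicit false
set_option linter.dupNamespace false  -- the mandated namespace repeats the summit's segment (`HodgeConjecture.HodgeConjecture`)

noncomputable section

open MeasureTheory MeasureTheory.Measure Set NumberField IsDedekindDomain Filter Topology Metric
open scoped NNReal ENNReal
open Literature.MeasureTheory.Group Literature.NumberTheory.Automorphic Literature.NumberTheory.Automorphic.UnitaryGroup AdelicGroupData
open Summit.HodgeConjecture.HodgeConjecture.Cruxes.H413.K2E1BLBorelSpacesU2Defs
open Summit.HodgeConjecture.HodgeConjecture.Cruxes.H413.K2E1BLBorelOperatorsU2Defs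
open Summit.HodgeConjecture.HodgeConjecture.Cruxes.H413.K2E1ChiHomogeneousL2U2 (hL2_chi_of_lt)
open Summit.HodgeConjecture.HodgeConjecture.Cruxes.H413.K2E1BLHomogeneousL2U3 (memLp_two_of_ae_norm_comp_pZX_le_cm_three)

namespace Summit.HodgeConjecture.HodgeConjecture.Cruxes.H413.K2E1ChiHomogeneousL2U3

/-! ## The CM head (`N = 3`, `σ₀ = 2`): the letter `hL2` of the `(χ,τ)` uniqueness head at rank 3, transfer discharged -/

section CM

variable (L : Type) [Field L] [NumberField L] [IsCMField L]
  [MeasurableSpace (quasiSplit (↥(maximalRealSubfield L)) L (IsCMField.complexConj L) 3).Adelic]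
  [BorelSpace (quasiSplit (↥(maximalRealSubfield L)) L (IsCMField.complexConj L) 3).Adelic]

/-- **A HOMOGENEOUS `(χ, τ)` SOLUTION IS IN `L²(μ)` FOR THE CM PAIR AT `N = 3`** (`σ₀ = 2`, the `U(2,1)` Godement abscissa) — the `hL2` slot of the N = 3 `(χ,τ)` uniqueness head
BYTE-FOR-BYTE (`ι := iota hb`, `P := cnstN k a μZ`, constant term `Lz z b′`): ★ RANK-GENERIC `K2E1ChiHomogeneousL2U2.hL2_chi_of_lt` at `σ₀ := 2` with the transfer letter `htr`
discharged by ★ `K2E1BLHomogeneousL2U3.memLp_two_of_ae_norm_comp_pZX_le_cm_three` (P2a-ι₃ comparison frame `(L μ νG hβ hμZ)`); the N = 3 twin of ★ `hL2_chi_cm_two` (`2 ↦ 3`, `1 < Re z ↦ 2 < Re z`),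
exactly as ★ `K2E1BLHomogeneousL2U3.hL2_cm_three` twins ★ `hL2_cm_two`.  Remaining letters: K2's `hK1` for `h i₀`, P3-C's `hδι`, and `hδL` (★ rank-generic §2 of the N = 2 file, columnwise).
[cite: BernsteinLapid2019, §4 Claim 2 (p. 9), Claims 4–5 (p. 10)] [cite: MoeglinWaldspurger1995, I.4.10] -/
theorem hL2_chi_cm_three
    (μ : Measure (quasiSplit (↥(maximalRealSubfield L)) L (IsCMField.complexConj L) 3).automorphicQuotient)
    [(quasiSplit (↥(maximalRealSubfield L)) L (IsCMField.complexConj L) 3).IsAutomorphicMeasure μ]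
    (νG : Measure (quasiSplit (↥(maximalRealSubfield L)) L (IsCMField.complexConj L) 3).Adelic) [νG.IsHaarMeasure] [νG.IsInvInvariant]
    {β : (quasiSplit (↥(maximalRealSubfield L)) L (IsCMField.complexConj L) 3).Adelic → ℝ≥0∞}
    (hβ : IsCoveringWeight ↥((arithmeticBorel (↥(maximalRealSubfield L)) L (IsCMField.complexConj L) 3).map
      (quasiSplit (↥(maximalRealSubfield L)) L (IsCMField.complexConj L) 3).arithmeticSubgroup.subtype) β)
    {μZ : Measure (borelQuotient (↥(maximalRealSubfield L)) L (IsCMField.complexConj L) 3)}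
    (hμZ : ∀ f : borelQuotient (↥(maximalRealSubfield L)) L (IsCMField.complexConj L) 3 → ℝ≥0∞, Measurable f →
      ∫⁻ z, f z ∂μZ = ∫⁻ g, β g * f (toBorelQuotient (↥(maximalRealSubfield L)) L (IsCMField.complexConj L) 3 g) ∂νG)
    (k n : ℕ) {I : Type*} (i₀ : I) {h : I → (quasiSplit (↥(maximalRealSubfield L)) L (IsCMField.complexConj L) 3).Adelic → ℂ}
    {a a₀ : ℝ≥0} (ha₀ : 0 < a₀) (haa₀ : a ≤ a₀) (hfin : μZ {z | a < borelQuotHeight (↥(maximalRealSubfield L)) L (IsCMField.complexConj L) 3 z} ≠ ∞)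
    (hb : IotaBound (↥(maximalRealSubfield L)) L (IsCMField.complexConj L) 3 k a μ μZ)
    (hs : ShiftBound (↥(maximalRealSubfield L)) L (IsCMField.complexConj L) 3 k a a₀ νG μZ (h i₀))
    (T : I → HX (↥(maximalRealSubfield L)) L (IsCMField.complexConj L) 3 k μ →L[ℂ] HX (↥(maximalRealSubfield L)) L (IsCMField.complexConj L) 3 k μ)
    (hδι : deltaShift hs ∘L iota hb = restrHN (↥(maximalRealSubfield L)) L (IsCMField.complexConj L) 3 k haa₀ μZ ∘L iota hb ∘L T i₀)
    {C m : ℝ} (hC : 0 ≤ C) (hm : 0 ≤ m)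
    (hK1 : ∀ f : HNcusp (↥(maximalRealSubfield L)) L (IsCMField.complexConj L) 3 k a μZ,
      ∀ᵐ x ∂(weightedTruncMeasure (↥(maximalRealSubfield L)) L (IsCMField.complexConj L) 3 k a₀ μZ),
        ‖rightConvFun (↥(maximalRealSubfield L)) L (IsCMField.complexConj L) 3 νG (h i₀)
            ((f : HN (↥(maximalRealSubfield L)) L (IsCMField.complexConj L) 3 k a μZ) : borelQuotient (↥(maximalRealSubfield L)) L (IsCMField.complexConj L) 3 → ℂ) x‖ ≤
          C * ‖f‖ * ((borelQuotHeight (↥(maximalRealSubfield L)) L (IsCMField.complexConj L) 3 x : ℝ)) ^ (-m))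
    {B : Type*} [NormedAddCommGroup B] [NormedSpace ℂ B] (Lz : ℂ → B →L[ℂ] HN (↥(maximalRealSubfield L)) L (IsCMField.complexConj L) 3 k a μZ)
    (hδL : ∀ z ∈ ball (0 : ℂ) (n + 2), 2 < z.re → ∀ b' : B, ∃ M : ℝ, ∀ᵐ x ∂(weightedTruncMeasure (↥(maximalRealSubfield L)) L (IsCMField.complexConj L) 3 k a₀ μZ),
      ‖(deltaShift hs (Lz z b') : borelQuotient (↥(maximalRealSubfield L)) L (IsCMField.complexConj L) 3 → ℂ) x‖ ≤ M)
    {X' : Type*} [NormedAddCommGroup X'] [NormedSpace ℂ X'] (Q : HX (↥(maximalRealSubfield L)) L (IsCMField.complexConj L) 3 k μ →L[ℂ] X') :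
    ∀ z ∈ ball (0 : ℂ) (n + 2), 2 < z.re → (∫ x, h i₀ x * (((borelHeight x : ℝ≥0) : ℝ) : ℂ) ^ z ∂νG).im ≠ 0 →
      ∀ (ψ : HX (↥(maximalRealSubfield L)) L (IsCMField.complexConj L) 3 k μ) (b' : B),
        (∀ i, T i ψ = (∫ x, h i x * (((borelHeight x : ℝ≥0) : ℝ) : ℂ) ^ z ∂νG) • ψ) →
          cnstN (↥(maximalRealSubfield L)) L (IsCMField.complexConj L) 3 k a μZ (iota hb ψ) = Lz z b' → Q ψ = 0 →
            MemLp (ψ : (quasiSplit (↥(maximalRealSubfield L)) L (IsCMField.complexConj L) 3).automorphicQuotient → ℂ) 2 μ :=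
  have hfin₀ : μZ {z | a₀ < borelQuotHeight (↥(maximalRealSubfield L)) L (IsCMField.complexConj L) 3 z} ≠ ∞ :=
    ((measure_mono fun _ hz => lt_of_le_of_lt haa₀ hz).trans_lt (lt_top_iff_ne_top.2 hfin)).ne
  hL2_chi_of_lt 2 n i₀ ha₀ haa₀ hb hs T hδι hC hm hK1 Lz hδL (fun ψ _ hM => memLp_two_of_ae_norm_comp_pZX_le_cm_three L μ νG hβ hμZ k ψ ha₀ hfin₀ hM) Q

end CM

end Summit.HodgeConjecture.HodgeConjecture.Cruxes.H413.K2E1ChiHomogeneousL2U3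

end
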